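import Summits.QuantumAdvantage.QuantumAdvantage.Theorems.MobiusLadderLiouvilleNotPPolyOneTimePadLine
import Summits.QuantumAdvantage.QuantumAdvantage.Theorems.MobiusLadderLiouvilleNotTC0
import Summits.QuantumAdvantage.QuantumAdvantage.Theorems.MobiusLadderLiouvilleMemBQP
import Literature.Computability.Complexity.PPolyTuringClosure
import Literature.Computability.Cryptography.ShorAssemblyLeavesProofs
import HarnessLib

/-!
# Crux-strategist scratch r1 (RESTATED re-audit, BC2 REDIRECT test) — crux `MobiusLadder.LiouvilleNotPPoly`
# (stmt-QuantumAdvantage-1389)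

planner-cstrat-stmt-QuantumAdvantage-1389-r1-0, 2026-08-17. Companion of STRATEGY-CENSUS.md §10 (r1 addendum).
For every decomposition candidate `X₁ ∧ … ∧ X_k → X` (X = `LiouvilleNotPPoly`) this file
(A) TYPES the pieces over existing declarations, (B) PROVES the assembly and thereby exhibits its
length (BC2 (b): a one-line seam disqualifies), (C) proves the ONE-LINE certificates that make a
piece ≥ S (`QuantumAdvantage`) or ≥ X given its partner (BC2 (c)). The literal cheap probes
(`first | exact? | simpa | aesop`) are run in `bc/Probes.lean`. No `sorry`.
-/

set_option linter.dupNamespace false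

noncomputable section

namespace Summit.QuantumAdvantage.QuantumAdvantage.Cruxes.LiouvilleNotPPoly.StrategistR1

open _root_.Computability
open Literature.Computability.Complexity
open Literature.Computability.QuantumComplexity (FACT)
open Summit.QuantumAdvantage.QuantumAdvantage.Theses.MobiusLadder (LiouvilleNotPPoly LiouvilleOrthogonalTC0
  LiouvilleNotTC0 LiouvilleMemBQP)
open Summit.QuantumAdvantage.QuantumAdvantage.Theses.CircuitLB (ClbFactNotPpoly)
open Summit.QuantumAdvantage.QuantumAdvantage.Theorems.LiouvilleNotPPoly
open Summit.QuantumAdvantage.QuantumAdvantage.Theorems.LiouvilleNotPPoly.OneTimePad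
open Summit.QuantumAdvantage.QuantumAdvantage.Theorems.MobiusLadder (LiouvilleMemBQP_proof LiouvilleNotTC0_proof)
open Filter Finset

/-- The Liouville language of the crux, verbatim. -/
abbrev Llam : Language Bool :=
  encodingNatBool.toLanguage {N : ℕ | ArithmeticFunction.liouville N = -1}

theorem crux_def : LiouvilleNotPPoly ↔ Llam ∉ PPoly := Iff.rfl
theorem summit_def : QuantumAdvantage ↔ ∃ L : Language Bool, L ∈ Literature.Computability.Cryptography.BQP ∧ L ∉ BPP :=
  Iff.rfl

/-! ## §A  The pieces (every candidate decomposition's X₁ … X_k, typed) -/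

/-- D1 piece 2 (p1): material-implication form of "FACT ≤ λ". -/
def LambdaToFact : Prop := Llam ∈ PPoly → FACT ∈ PPoly

/-- D1′ piece 2 (r1, the HONEST reduction form): `FACT ≤ᵀₚ L_λ` — a polynomial-time Cook reduction
of the bounded-divisor language to the Liouville language (Adleman–McCurley 1994 open problem; no
mechanism known; absent from the oracle-factoring literature Maurer1995, DPS2023). -/
def FactCookReducesToLiouville : Prop := PolyTimeTuringReducible FACT Llam

/-- D2 piece 2 (p1): the TC⁰-to-P/poly lift for `λ`. -/
def TC0Lift : Prop := Llam ∉ TC0 → Llam ∉ PPoly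

/-- D5 piece 1 (r1): the UNIFORM core — the only form in which `closes` consumes X. -/
def LiouvilleNotBPP : Prop := Llam ∉ BPP

/-- D5 piece 2 (r1): advice elimination for `λ` ("a poly-size family for λ can be made uniform"). -/
def AdviceElim : Prop := Llam ∈ PPoly → Llam ∈ BPP

/-- D9 piece 1 (r1): `NP ⊄ P/poly` — a CONSEQUENCE of X (landed `NP_not_subset_PPoly_of_liouvilleNotPPoly`),
not known to imply S. -/
def NPNotPPoly : Prop := ¬ (Nondeterministic.NP ⊆ PPoly)

/-- D9 piece 2 (r1): `λ` is NP-hard under Cook reductions. (Incredible: with `L_λ ∈ NP ∩ coNP`,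
landed `liouville_mem_NP`/`liouville_mem_coNP`, it gives NP = coNP via `P^{NP ∩ coNP} = NP ∩ coNP`.) -/
def LiouvilleNPHardCook : Prop := ∀ L ∈ Nondeterministic.NP, PolyTimeTuringReducible L Llam

/-- D-CR piece 1 (line L1 `Lines/Sketch.lean`, verbatim): character rigidity with growing conductor. -/
def CharRigidityPPoly : Prop :=
  ∀ f : ℕ → ℤ, (∀ m n : ℕ, f (m * n) = f m * f n) → (∀ n : ℕ, n ≠ 0 → f n = 1 ∨ f n = -1) →
    encodingNatBool.toLanguage {N : ℕ | f N = -1} ∈ PPoly →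
    ∃ k : ℕ, ∀ᶠ n : ℕ in atTop, ∃ d : ℤ, |d| ≤ 2 ^ n ^ k ∧
      8 * ((range (2 ^ n)).filter fun p => p.Prime ∧ jacobiSym d p ≠ f p).card ≤
        ((range (2 ^ n)).filter Nat.Prime).card

/-- D-CR piece 2 (line L1, verbatim): twin-freeness in density at every polynomial bit budget (GRH-true). -/
def TwinFreeDensity : Prop :=
  ∀ k : ℕ, ∀ᶠ n : ℕ in atTop, ∀ d : ℤ, |d| ≤ 2 ^ n ^ k →
    3 * ((range (2 ^ n)).filter Nat.Prime).card ≤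
      8 * ((range (2 ^ n)).filter fun p => p.Prime ∧ jacobiSym d p ≠ -1).card

/-- D-CR piece 1 AT ITS ONLY USE (`f = λ`), verbatim from line L1's calibration. -/
def CharRigidityAtLiouville : Prop :=
  Llam ∈ PPoly →
    ∃ k : ℕ, ∀ᶠ n : ℕ in atTop, ∃ d : ℤ, |d| ≤ 2 ^ n ^ k ∧
      8 * ((range (2 ^ n)).filter fun p => p.Prime ∧ jacobiSym d p ≠ -1).card ≤
        ((range (2 ^ n)).filter Nat.Prime).card

/-- S⁺₄ (p1, verbatim): the "two-versus-three primes" promise hardness. -/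
def TwoVsThreePrimesHard : Prop :=
  ¬ ∃ L ∈ PPoly, ∀ N : ℕ, (ArithmeticFunction.cardFactors N = 2 ∨ ArithmeticFunction.cardFactors N = 3) →
      (encodeNat N ∈ L ↔ ArithmeticFunction.cardFactors N = 3)

/-! ## §B  The assemblies, proved — and their lengths (BC2 (b)) -/

/-- D1 assembly: ONE line (modus tollens). -/
theorem X_of_D1 (h₁ : ClbFactNotPpoly) (h₂ : LambdaToFact) : LiouvilleNotPPoly :=
  fun hL => h₁ (h₂ hL)

/-- D1′ assembly: ONE line over the landed closure theorem `mem_PPoly_of_polyTimeTuringReducible`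
(the mathematics of "P/poly is closed under Cook reductions" is real but already a tree theorem; the
seam between the two pieces is modus tollens). -/
theorem X_of_D1' (h₁ : ClbFactNotPpoly) (h₂ : FactCookReducesToLiouville) : LiouvilleNotPPoly :=
  fun hL => h₁ (mem_PPoly_of_polyTimeTuringReducible h₂ hL)

/-- D2 assembly: ONE line through the landed glue item 1398. -/
theorem X_of_D2 (h₁ : LiouvilleOrthogonalTC0) (h₂ : TC0Lift) : LiouvilleNotPPoly :=
  h₂ (LiouvilleNotTC0_proof h₁)

/-- D5 assembly: ONE line. -/
theorem X_of_D5 (h₁ : LiouvilleNotBPP) (h₂ : AdviceElim) : LiouvilleNotPPoly :=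
  fun hL => h₁ (h₂ hL)

/-- D9 assembly: THREE lines (every NP language Cook-reduces to an easy λ, so NP ⊆ P/poly). -/
theorem X_of_D9 (h₁ : NPNotPPoly) (h₂ : LiouvilleNPHardCook) : LiouvilleNotPPoly := by
  intro hL
  exact h₁ fun L hLNP => mem_PPoly_of_polyTimeTuringReducible (h₂ L hLNP) hL

/-- `λ(p) = −1` at a prime. -/
theorem liouville_prime {p : ℕ} (hp : p.Prime) : ArithmeticFunction.liouville p = -1 := by
  rw [ArithmeticFunction.liouville_apply hp.ne_zero, ArithmeticFunction.cardFactors_apply_prime hp,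
    pow_one]

/-- For `f = λ` the disagreement set of CR is the non-inert set of TF. -/
theorem filter_disagree_liouville_eq (d : ℤ) (n : ℕ) :
    ((range (2 ^ n)).filter fun p => p.Prime ∧ jacobiSym d p ≠ ArithmeticFunction.liouville p) =
      ((range (2 ^ n)).filter fun p => p.Prime ∧ jacobiSym d p ≠ -1) := by
  refine Finset.filter_congr fun p _ => ?_
  constructor
  · rintro ⟨hp, h⟩
    exact ⟨hp, by rwa [liouville_prime hp] at h⟩
  · rintro ⟨hp, h⟩
    exact ⟨hp, by rwa [liouville_prime hp]⟩

theorem liouville_eq_one_or {n : ℕ} (hn : n ≠ 0) :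
    ArithmeticFunction.liouville n = 1 ∨ ArithmeticFunction.liouville n = -1 := by
  rw [ArithmeticFunction.liouville_apply hn]
  exact neg_one_pow_eq_or ℤ _

theorem card_primesBelow_ne_zero {n : ℕ} (hn : 2 ≤ n) :
    ((range (2 ^ n)).filter Nat.Prime).card ≠ 0 := by
  rw [Finset.card_ne_zero]
  refine ⟨2, Finset.mem_filter.2 ⟨Finset.mem_range.2 ?_, Nat.prime_two⟩⟩
  calc 2 < 4 := by norm_num
    _ = 2 ^ 2 := by norm_num
    _ ≤ 2 ^ n := Nat.pow_le_pow_right (by norm_num) hn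

/-- D-CR assembly (line L1's `LiouvilleNotPPoly_of`, verbatim): EIGHT lines — instantiate CR at `f = λ`,
pick an `n` where CR's "≤ 1/8 of the primes disagree" and TF's "≥ 3/8 disagree" both hold, `omega`.
The two pieces' conclusions are negations of each other up to the constants; the seam is modus
tollens dressed in one inequality. -/
theorem X_of_DCR (hCR : CharRigidityPPoly) (hTF : TwinFreeDensity) : LiouvilleNotPPoly := by
  change Llam ∉ PPoly
  intro hmem
  obtain ⟨k, hk⟩ := hCR (fun N => ArithmeticFunction.liouville N) ArithmeticFunction.liouville_apply_mul
    (fun n hn => liouville_eq_one_or hn) hmem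
  obtain ⟨n, ⟨⟨d, hd, hCRn⟩, hTFn⟩, hn2⟩ := ((hk.and (hTF k)).and (eventually_ge_atTop 2)).exists
  have hA := hTFn d hd
  rw [filter_disagree_liouville_eq] at hCRn
  have hπ : ((range (2 ^ n)).filter Nat.Prime).card = 0 := by omega
  exact card_primesBelow_ne_zero hn2 hπ

-- D3 / S⁺ (one-piece "splits", landed): each strengthening ALONE gives X.
example : LiouvilleOrthogonalPPoly → LiouvilleNotPPoly := liouvilleNotPPoly_of_apex
example : MildAvgHard 1 → LiouvilleNotPPoly := liouvilleNotPPoly_of_mildAvgHard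

/-- S⁺₄ ⇒ X (p1's `crux_of_twoVsThree`, verbatim): a promise restriction of X is ≥ X. -/
theorem X_of_twoVsThree (hS : TwoVsThreePrimesHard) : LiouvilleNotPPoly := by
  intro hL
  refine hS ⟨Llam, hL, fun N hN => ?_⟩
  have hN0 : N ≠ 0 := by
    rintro rfl
    simp at hN
  have hmem : encodeNat N ∈ Llam ↔ ArithmeticFunction.liouville N = -1 := by
    show encodingNatBool.encode N ∈ encodingNatBool.toLanguage _ ↔ _
    rw [Encoding.mem_toLanguage_iff, Set.mem_setOf_eq]
  rw [hmem, liouville_eq_neg_one_iff_odd hN0]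
  rcases hN with h2 | h3
  · rw [h2]; constructor
    · intro h; exact absurd h (by decide)
    · intro h; exact absurd h (by decide)
  · rw [h3]; exact ⟨fun _ => rfl, fun _ => by decide⟩

/-! ## §C  The (c)-certificates: which pieces are ≥ S, or ≥ X given their partner — each in ONE line -/

/-- `FACT ∉ P/poly` is summit-or-harder: with Shor (`FACT_mem_BQP_holds`, landed) and Adleman
(`BPP_subset_PPoly_holds`, landed) it gives the summit in three lines — exactly CircuitLB's `closes`. -/
theorem S_of_clbFactNotPpoly (h : ClbFactNotPpoly) : QuantumAdvantage := by
  by_contra hS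
  exact h (BPP_subset_PPoly_holds (by_contra fun hB =>
    hS ⟨FACT, Literature.Computability.Cryptography.FACT_mem_BQP_holds, hB⟩))

/-- Hence every "A ∉ P/poly" piece with `A ≤ᵀₚ FACT` is summit-or-harder (first horn of the
reduction dichotomy, kernel form). -/
theorem S_of_notPPoly_of_reducibleToFact {A : Language Bool} (hA : PolyTimeTuringReducible A FACT)
    (h : A ∉ PPoly) : QuantumAdvantage :=
  S_of_clbFactNotPpoly fun hF => h (mem_PPoly_of_polyTimeTuringReducible hA hF)

/-- The uniform core `L_λ ∉ BPP` is summit-or-harder: ONE line with the landed `LiouvilleMemBQP_proof`. -/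
theorem S_of_liouvilleNotBPP (h : LiouvilleNotBPP) : QuantumAdvantage :=
  ⟨Llam, LiouvilleMemBQP_proof, h⟩

/-- X itself is summit-or-harder (the audit's verdict, kernel form): X ⇒ L_λ ∉ BPP ⇒ S. -/
theorem S_of_X (h : LiouvilleNotPPoly) : QuantumAdvantage :=
  S_of_liouvilleNotBPP (liouville_not_mem_BPP_of_liouvilleNotPPoly h)

/-- The strengthenings are ≥ X (landed) hence ≥ S. -/
theorem S_of_apex (h : LiouvilleOrthogonalPPoly) : QuantumAdvantage := S_of_X (liouvilleNotPPoly_of_apex h)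
theorem S_of_mildAvgHard (h : MildAvgHard 1) : QuantumAdvantage := S_of_X (liouvilleNotPPoly_of_mildAvgHard h)
theorem S_of_twoVsThree (h : TwoVsThreePrimesHard) : QuantumAdvantage := S_of_X (X_of_twoVsThree h)

/-- **The implication-companion lemma** (why every `{W, W → X}` split fails (c) as soon as it fails (b)):
a companion of the shape `W → X` is implied by X outright, and given its partner W it implies X —
so relative to the partner it IS X. -/
theorem companion_iff {W X : Prop} (hW : W) : (W → X) ↔ X :=
  ⟨fun h => h hW, fun hX _ => hX⟩

/-- Instances: D1's `LambdaToFact`, D2's `TC0Lift`, D5's `AdviceElim` are each implied by X … -/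
theorem lambdaToFact_of_X (h : LiouvilleNotPPoly) : LambdaToFact := fun hL => absurd hL h
theorem tc0Lift_of_X (h : LiouvilleNotPPoly) : TC0Lift := fun _ => h
theorem adviceElim_of_X (h : LiouvilleNotPPoly) : AdviceElim := fun hL => absurd hL h

/-- … and equivalent to X given their partner. -/
theorem lambdaToFact_iff_X (h₁ : ClbFactNotPpoly) : LambdaToFact ↔ LiouvilleNotPPoly :=
  ⟨X_of_D1 h₁, lambdaToFact_of_X⟩
theorem tc0Lift_iff_X (h₁ : LiouvilleOrthogonalTC0) : TC0Lift ↔ LiouvilleNotPPoly :=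
  ⟨X_of_D2 h₁, tc0Lift_of_X⟩
theorem adviceElim_iff_X (h₁ : LiouvilleNotBPP) : AdviceElim ↔ LiouvilleNotPPoly :=
  ⟨X_of_D5 h₁, adviceElim_of_X⟩

/-- D-CR: CR gives CR-at-λ, CR-at-λ is implied by X VACUOUSLY, and given TF it is equivalent to X
(line L1's calibration, landed as `charRigidityAtLiouville_iff_of_twinFreeDensity`). -/
theorem charRigidityAtLiouville_of_CR (hCR : CharRigidityPPoly) : CharRigidityAtLiouville := by
  intro hmem
  obtain ⟨k, hk⟩ := hCR (fun N => ArithmeticFunction.liouville N) ArithmeticFunction.liouville_apply_mul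
    (fun n hn => liouville_eq_one_or hn) hmem
  refine ⟨k, hk.mono fun n ⟨d, hd, h⟩ => ⟨d, hd, ?_⟩⟩
  rwa [filter_disagree_liouville_eq] at h

theorem charRigidityAtLiouville_of_X (hX : LiouvilleNotPPoly) : CharRigidityAtLiouville :=
  fun hmem => absurd hmem hX

theorem X_of_charRigidityAtLiouville_TF (hCR : CharRigidityAtLiouville) (hTF : TwinFreeDensity) :
    LiouvilleNotPPoly := by
  change Llam ∉ PPoly
  intro hmem
  obtain ⟨k, hk⟩ := hCR hmem
  obtain ⟨n, ⟨⟨d, hd, hCRn⟩, hTFn⟩, hn2⟩ := ((hk.and (hTF k)).and (eventually_ge_atTop 2)).exists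
  have hA := hTFn d hd
  have hπ : ((range (2 ^ n)).filter Nat.Prime).card = 0 := by omega
  exact card_primesBelow_ne_zero hn2 hπ

theorem charRigidityAtLiouville_iff_X (hTF : TwinFreeDensity) : CharRigidityAtLiouville ↔ LiouvilleNotPPoly :=
  ⟨fun h => X_of_charRigidityAtLiouville_TF h hTF, charRigidityAtLiouville_of_X⟩

/-- D9's first piece is a CONSEQUENCE of X (landed), so `{NPNotPPoly, LiouvilleNPHardCook}` has the
shape {consequence of X, incredible companion}. -/
theorem npNotPPoly_of_X (h : LiouvilleNotPPoly) : NPNotPPoly := NP_not_subset_PPoly_of_liouvilleNotPPoly h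

/-! ## §D  Refutation surface of the new pieces (what would kill each; all elementary) -/

/-- `AdviceElim` together with any P/poly upper bound puts `λ` in BPP, i.e. refutes the summit-bearing
uniform core; conversely `L_λ ∈ BPP` proves `AdviceElim` outright. -/
theorem adviceElim_of_mem_BPP (h : Llam ∈ BPP) : AdviceElim := fun _ => h
theorem lambdaToFact_of_FACT_mem_PPoly (h : FACT ∈ PPoly) : LambdaToFact := fun _ => h

end Summit.QuantumAdvantage.QuantumAdvantage.Cruxes.LiouvilleNotPPoly.StrategistR1

end
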